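import Literature.NumberTheory.EllipticCurves.PAdicOneVariableUnitsSocketInjective
import Literature.NumberTheory.GaloisRepresentations.LubinTateColemanLogDerivSurjTwo
import Literature.NumberTheory.GaloisRepresentations.LubinTateComparisonTraceTransportTwo
import HarnessLib

/-!
# `p = 2`: de Shalit's `i : 𝒰 → Λ(𝒢)` is INJECTIVE on the norm-coherent units of the Lubin–Tate tower of
# `f' = π'X + X²`, `π' = 2u`, `u ≠ 1` — `D_β = D_{β'}` levelwise forces `β = β'` (I.3.4 Corollary)

Topic `NumberTheory/EllipticCurves`; namespace `Literature.NumberTheory.EllipticCurves`.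

De Shalit, *Iwasawa theory of elliptic curves with complex multiplication* (1987), I.3.4 Corollary (p. 18):
"The map `i` is an injective homomorphism of `ℤ_p[[𝒢]]`-modules".  The measure of `β` is
`D_β = comap ((x⁻¹ D_{H_β})|_{ℤ₂ˣ}) ψ` with `H_β = θ((δβ)~ ∘ ϑ)` read through `𝒪_{ℂ_F}`;
`PAdicOneVariableUnitsSocketInjective.lean` showed `D_β = D_{β'}` ⟹ `H_β = H_{β'}`.  THIS file peels
the three remaining maps:

* §1 (generic, any commutative ring) ★ `PowerSeries.subst_injective_of_isUnit_coeff_one` — substitution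
  of a series `φ` with `φ(0) = 0` and UNIT linear coefficient is injective (leading term `g_k φ₁^k`);
* §2 ★ `tildeSer_injective_of_ne_one` — de Shalit's `h ↦ h̃ = h − u·(h ∘ f')` is injective on `𝒪[F]⟦X⟧`
  as soon as `u ≠ 1` (lowest term: `h_k (1 − u π'^k) = 0`; `k = 0` uses `u ≠ 1` in the domain `𝒪[F]`,
  `k ≥ 1` that `1 − uπ'^k` is a unit); at `u = 1` the kernel is the constants (not needed here);
* §3 the coefficient maps `𝒪[F] → 𝒪_{ℂ_F}` and `𝒪_{ℂ_F} → ℂ_F → ℂ_[2]` are injective on series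
  (`map_injective` with `coe_algebraMap_intToUnrCoeff`: the composite is `F ⊆ ℂ_F` on `𝒪[F]`), and
  `∘ (ϑ.map ι)` is injective (§1: `ϑ(0) = 0`, `ϑ'(0)` a unit);
* §4 ★★★ `NormCoherentUnits.eq_of_comap_μ_eq` — **`D_β = D_{β'}` levelwise ⟹ `β = β'`** for `F` of
  characteristic `0` with residue field `𝔽₂`, `2` a uniformizer, `π' = 2u` with `u ≠ 1`
  (`(δ·)~` injective by §2, `δ` injective on `𝒰` at `q = 2` by `logDeriv_injective`).

Everything is proved; no named facts, no definitions, no instances (section-local instance attributes as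
in the siblings), no `sorry`.

## References

* [deShalit1987] E. de Shalit, *Iwasawa theory of elliptic curves with complex multiplication* (1987),
  I.3.3 (7′) (p. 17), I.3.4 Corollary (p. 18), I.3.12 Corollary (p. 23), I.2.1 (p. 14).
-/

noncomputable section

open Filter
open scoped Topology Classical

namespace Literature.NumberTheory.EllipticCurves

/-! ### §1. Substitution of a series with unit linear term is injective -/

section SubstInjective

variable {R : Type*} [CommRing R]

/-- `[X^d] φ^d = ([X^1] φ)^d` when `φ(0) = 0`. [folklore] -/
private theorem coeff_self_pow_of_constantCoeff_eq_zero {φ : PowerSeries R} (h0 : PowerSeries.constantCoeff φ = 0)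
    (d : ℕ) : PowerSeries.coeff d (φ ^ d) = (PowerSeries.coeff 1 φ) ^ d := by
  have hφX : φ = PowerSeries.X * PowerSeries.mk fun p => PowerSeries.coeff (p + 1) φ := by
    conv_lhs => rw [PowerSeries.eq_shift_mul_X_add_const φ]
    rw [h0, map_zero, add_zero, mul_comm]
  have h1 : PowerSeries.coeff 1 φ = PowerSeries.constantCoeff (PowerSeries.mk fun p => PowerSeries.coeff (p + 1) φ) := by
    rw [PowerSeries.constantCoeff_mk]
  rw [h1, hφX, mul_pow, PowerSeries.coeff_X_pow_mul', if_pos le_rfl, Nat.sub_self,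
    PowerSeries.coeff_zero_eq_constantCoeff_apply, map_pow, ← hφX]

/-- ★ **Substitution of a power series `φ` with `φ(0) = 0` and unit linear coefficient is injective**
(`[X^k](g ∘ φ) = g_k φ₁^k` at the lowest non-zero coefficient `g_k` of `g`). [folklore]
[cite: deShalit1987, I.2.1 (p. 14)] -/
theorem PowerSeries.subst_injective_of_isUnit_coeff_one {φ : PowerSeries R}
    (h0 : PowerSeries.constantCoeff φ = 0) (h1 : IsUnit (PowerSeries.coeff 1 φ)) :
    Function.Injective (fun g : PowerSeries R => PowerSeries.subst φ g) := by
  have hfs : PowerSeries.HasSubst φ := PowerSeries.HasSubst.of_constantCoeff_zero' h0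
  intro g g' hgg'
  rw [← sub_eq_zero]
  set D := g - g'
  have hD : PowerSeries.subst φ D = 0 := by
    simp only [D, PowerSeries.subst_sub hfs]
    exact sub_eq_zero.mpr hgg'
  by_contra hne
  have hex : ∃ n, PowerSeries.coeff n D ≠ 0 := by
    by_contra hall
    push Not at hall
    exact hne (PowerSeries.ext fun n => by rw [hall n, map_zero])
  let n₀ := Nat.find hex
  have hn₀ : PowerSeries.coeff n₀ D ≠ 0 := Nat.find_spec hex
  have hlt : ∀ m < n₀, PowerSeries.coeff m D = 0 := fun m hm => by
    have := Nat.find_min hex hm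
    push Not at this
    exact this
  have hc := congrArg (PowerSeries.coeff n₀) hD
  rw [map_zero, PowerSeries.coeff_subst' hfs,
    finsum_eq_sum_of_support_subset _ (s := Finset.range (n₀ + 1)), Finset.sum_range_succ,
    Finset.sum_eq_zero, zero_add, coeff_self_pow_of_constantCoeff_eq_zero h0, smul_eq_mul] at hc
  · exact hn₀ ((h1.pow n₀).mul_left_eq_zero.mp hc)
  · intro m hm
    rw [hlt m (Finset.mem_range.mp hm), zero_smul]
  · intro d hd
    rw [Function.mem_support] at hd
    rw [Finset.coe_range, Set.mem_Iio]
    by_contra hnd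
    push Not at hnd
    exact hd (by
      rw [(PowerSeries.X_pow_dvd_iff.mp (pow_dvd_pow_of_dvd (PowerSeries.X_dvd_iff.mpr h0) d)) n₀ (by omega),
        smul_zero])

end SubstInjective

/-! ### §2. `h ↦ h̃ = h − u·(h ∘ f')` is injective for `u ≠ 1` -/

section TildeSer

open ValuativeRel IsLocalRing
open Literature.NumberTheory.GaloisRepresentations Literature.NumberTheory.GaloisRepresentations.IsNonarchimedeanLocalField
  Literature.NumberTheory.GaloisRepresentations.LubinTate

variable {F : Type} [Field F] [ValuativeRel F] [TopologicalSpace F] [IsNonarchimedeanLocalField F]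

attribute [local instance] ltNormUniformSpace ltNormIsUniformAddGroup rk1 nF nE fintypeResidueField

/-- `1 − u·π^k` is a unit of the discrete copy `LTCoeff F` of `𝒪[F]` for `k ≥ 1` (`π` a non-unit).
[folklore] -/
private theorem isUnit_one_sub_mul_pow {π : 𝒪[F]} (hπ : (valuation F).IsUniformizer (π : F)) (u : LTCoeff F)
    {k : ℕ} (hk : 0 < k) : IsUnit (1 - u * LTCoeff.of F π ^ k) := by
  have hmem : (LTCoeff.of F).symm u * π ^ k ∈ IsLocalRing.maximalIdeal 𝒪[F] := by
    refine Ideal.mul_mem_left _ _ (Ideal.pow_mem_of_mem _ ?_ k hk)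
    exact (IsLocalRing.mem_maximalIdeal _).mpr hπ.not_isUnit
  have h1 : IsUnit (1 - (LTCoeff.of F).symm u * π ^ k) := by
    have := IsLocalRing.isUnit_one_sub_self_of_mem_nonunits _ hmem
    exact this
  have h2 := h1.map (LTCoeff.of F)
  rwa [map_sub, map_one, map_mul, map_pow, RingEquiv.apply_symm_apply] at h2

/-- ★ **`h ↦ h̃ = h − u·(h ∘ f')` is injective on `𝒪[F]⟦X⟧` when `u ≠ 1`** (de Shalit's `(·)~` of I.3.3 (7′);
`f' = π'X + X^q` the special Lubin–Tate series): at the lowest non-zero coefficient `h_k` of `h ∈ ker`,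
`h_k(1 − uπ'^k) = 0`, impossible for `k ≥ 1` (`1 − uπ'^k` is a unit) and for `k = 0` (`u ≠ 1` in the domain
`𝒪[F]`). [cite: deShalit1987, I.3.3 (7′) (p. 17)] -/
theorem tildeSer_injective_of_ne_one (π : 𝒪[F]) (hπ : (valuation F).IsUniformizer (π : F)) {u : LTCoeff F}
    (hu : u ≠ 1) : Function.Injective (tildeSer π u) := by
  have hf := isLTSeries_ltSer π (F := F)
  have hfs : PowerSeries.HasSubst (ltSer F π) := PowerSeries.HasSubst.of_constantCoeff_zero' hf.constantCoeff_eq_zero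
  haveI : IsDomain (LTCoeff F) := inferInstanceAs (IsDomain 𝒪[F])
  intro h h' hhh'
  rw [← sub_eq_zero]
  set D := h - h'
  have hD : tildeSer π u D = 0 := by
    have : tildeSer π u D = tildeSer π u h - tildeSer π u h' := by
      simp only [D, sub_eq_add_neg, tildeSer_add]
      rw [show -h' = PowerSeries.C (-1 : LTCoeff F) * h' by rw [map_neg, map_one, neg_one_mul],
        tildeSer_C_mul, map_neg, map_one, neg_one_mul]
    rw [this, hhh', sub_self]
  by_contra hne
  have hex : ∃ n, PowerSeries.coeff n D ≠ 0 := by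
    by_contra hall
    push Not at hall
    exact hne (PowerSeries.ext fun n => by rw [hall n, map_zero])
  let n₀ := Nat.find hex
  have hn₀ : PowerSeries.coeff n₀ D ≠ 0 := Nat.find_spec hex
  have hlt : ∀ m < n₀, PowerSeries.coeff m D = 0 := fun m hm => by
    have := Nat.find_min hex hm
    push Not at this
    exact this
  -- `[X^{n₀}] (D ∘ f') = D_{n₀} π^{n₀}`
  have hsub : PowerSeries.coeff n₀ (PowerSeries.subst (ltSer F π) D) = PowerSeries.coeff n₀ D * LTCoeff.of F π ^ n₀ := by
    rw [PowerSeries.coeff_subst' hfs, finsum_eq_sum_of_support_subset _ (s := Finset.range (n₀ + 1)),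
      Finset.sum_range_succ, Finset.sum_eq_zero, zero_add, coeff_self_pow hf, smul_eq_mul]
    · intro m hm
      rw [hlt m (Finset.mem_range.mp hm), zero_smul]
    · intro d hd
      rw [Function.mem_support] at hd
      rw [Finset.coe_range, Set.mem_Iio]
      by_contra hnd
      push Not at hnd
      exact hd (by rw [coeff_pow_eq_zero_of_constantCoeff_eq_zero hf.constantCoeff_eq_zero (by omega), smul_zero])
  have hc := congrArg (PowerSeries.coeff n₀) hD
  rw [tildeSer_def, map_sub, PowerSeries.coeff_C_mul, hsub, map_zero, ← mul_assoc, mul_comm u, mul_assoc,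
    ← mul_one_sub, mul_eq_zero] at hc
  rcases hc with hc | hc
  · exact hn₀ hc
  · rcases Nat.eq_zero_or_pos n₀ with h0 | hpos
    · rw [h0, pow_zero, mul_one, sub_eq_zero] at hc
      exact hu hc.symm
    · exact (isUnit_one_sub_mul_pow hπ u hpos).ne_zero hc

end TildeSer

/-! ### §3–§4. `D_β = D_{β'}` forces `β = β'` -/

section NormCoherentUnitsInjective

open MvPowerSeries ValuativeRel IsLocalRing Field
open Literature.NumberTheory.GaloisRepresentations Literature.NumberTheory.GaloisRepresentations.IsNonarchimedeanLocalField
  Literature.NumberTheory.GaloisRepresentations.LubinTate Literature.NumberTheory.PAdicHodge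

variable {F : Type} [Field F] [ValuativeRel F] [TopologicalSpace F] [IsNonarchimedeanLocalField F]

attribute [local instance] ltNormUniformSpace ltNormIsUniformAddGroup rk1 nF nE fintypeResidueField
attribute [local instance] ltTower_U_normal

/-- The coefficient map `𝒪[F] → 𝒪̂_{F^nr} → 𝒪_{ℂ_F}` (on the discrete copies) is injective: composed with
`𝒪_{ℂ_F} ⊆ ℂ_F` it is the field embedding `F ⊆ ℂ_F` on `𝒪[F]`. [cite: CasselsFrohlichANT1967, Ch. VI §3.2] -/
theorem injective_algebraMap_comp_intToUnrCoeff :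
    Function.Injective ((algebraMap (UnrCoeff F) (CBall F)).comp
      ((intToUnrCoeff F).comp (LTCoeff.of F).symm.toRingHom)) := by
  intro a b hab
  have h := congrArg (fun z : CBall F => (z : CompletedAlgClosure F)) hab
  simp only [RingHom.comp_apply, coe_algebraMap_intToUnrCoeff] at h
  have h' : (((LTCoeff.of F).symm.toRingHom a : 𝒪[F]) : F) = (((LTCoeff.of F).symm.toRingHom b : 𝒪[F]) : F) :=
    (algebraMap F (CompletedAlgClosure F)).injective h
  exact (LTCoeff.of F).symm.injective (Subtype.ext h')

variable (hq : residueFieldCard F = 2) (h2 : (valuation F).IsUniformizer (((2 : ℕ) : 𝒪[F]) : F))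
  {σ₀ : absoluteGaloisGroup F} (hσ₀ : IsAbsArithFrob σ₀) (u : 𝒪[F]ˣ)
  {ε : (maxUnramifiedCompletion F)ˣ}
  (hε : maxUnramifiedCompletion.galAut F σ₀ (ε : maxUnramifiedCompletion F) =
    algebraMap 𝒪[F] (maxUnramifiedCompletion F) (u : 𝒪[F]) * (ε : maxUnramifiedCompletion F))
variable (θ : CompletedAlgClosure F →+* ℂ_[2]) (hθc : Continuous θ)
  (hθ1 : ∀ z : CBall F, ‖θ (z : CompletedAlgClosure F)‖ ≤ 1)
  (hθζ : ∀ ζ' : ℂ_[2], (∃ n : ℕ, ζ' ^ 2 ^ n = 1) →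
    ∃ ζ : CompletedAlgClosure F, (∃ n : ℕ, ζ ^ 2 ^ n = 1) ∧ θ ζ = ζ')
variable (e : 𝒪[F] ≃+* ℤ_[2])
  (ψ : (n : ℕ) → absoluteGaloisGroup F ⧸ (ltTower (isUniformizer_unit_mul h2 u)).U n → ZMod (2 ^ (n + 1)))
  (hψ : ∀ (n : ℕ) (σ : absoluteGaloisGroup F), σ ∈ (ltTower (isUniformizer_unit_mul h2 u)).U 0 →
    ψ n ((ltTower (isUniformizer_unit_mul h2 u)).proj n σ) = PadicInt.toZModPow (n + 1)
      (((Units.map (e : 𝒪[F] →+* ℤ_[2]).toMonoidHom).comp (lubinTateCharHom (isUniformizer_unit_mul h2 u)) σ :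
        ℤ_[2]ˣ) : ℤ_[2]))

/-- **`H_β = H_{β'}` ⟹ `(δβ)~ = (δβ')~`**: the maps `θ ∘ (𝒪_{ℂ_F} ⊆ ℂ_F)`, `∘ (ϑ.map ι)` and the coefficient map
`𝒪[F] → 𝒪_{ℂ_F}` are injective on power series. [cite: deShalit1987, I.3.3 (7′)–(8) (p. 17)] -/
theorem tildeSer_logDeriv_eq_of_map_subst_eq (β β' : NormCoherentUnits (isUniformizer_unit_mul h2 u))
    (h : (PowerSeries.subst ((compSeriesC h2 hσ₀ u hε).map (algebraMap (UnrCoeff F) (CBall F)))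
        ((tildeSer ((u : 𝒪[F]) * ((2 : ℕ) : 𝒪[F])) (LTCoeff.of F (u : 𝒪[F])) β.logDeriv).map
          ((algebraMap (UnrCoeff F) (CBall F)).comp
            ((intToUnrCoeff F).comp (LTCoeff.of F).symm.toRingHom)))).map (θ.comp (CBall F).subtype) =
      (PowerSeries.subst ((compSeriesC h2 hσ₀ u hε).map (algebraMap (UnrCoeff F) (CBall F)))
        ((tildeSer ((u : 𝒪[F]) * ((2 : ℕ) : 𝒪[F])) (LTCoeff.of F (u : 𝒪[F])) β'.logDeriv).map
          ((algebraMap (UnrCoeff F) (CBall F)).comp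
            ((intToUnrCoeff F).comp (LTCoeff.of F).symm.toRingHom)))).map (θ.comp (CBall F).subtype)) :
    tildeSer ((u : 𝒪[F]) * ((2 : ℕ) : 𝒪[F])) (LTCoeff.of F (u : 𝒪[F])) β.logDeriv =
      tildeSer ((u : 𝒪[F]) * ((2 : ℕ) : 𝒪[F])) (LTCoeff.of F (u : 𝒪[F])) β'.logDeriv := by
  -- peel `map (θ ∘ subtype)`
  have hθinj : Function.Injective (θ.comp (CBall F).subtype) :=
    θ.injective.comp Subtype.val_injective
  have h₁ := PowerSeries.map_injective (θ.comp (CBall F).subtype) hθinj h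
  -- peel `∘ (ϑ.map ι)`
  have hϑ0 : PowerSeries.constantCoeff ((compSeriesC h2 hσ₀ u hε).map (algebraMap (UnrCoeff F) (CBall F))) = 0 :=
    constantCoeff_map_eq_zero _ (constantCoeff_compSeriesC h2 hσ₀ u hε)
  have hϑ1 : IsUnit (PowerSeries.coeff 1 ((compSeriesC h2 hσ₀ u hε).map (algebraMap (UnrCoeff F) (CBall F)))) := by
    rw [PowerSeries.coeff_map]
    exact (isUnit_coeff_one_compSeriesC h2 hσ₀ u hε).map _
  have h₂ := PowerSeries.subst_injective_of_isUnit_coeff_one hϑ0 hϑ1 h₁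
  -- peel the coefficient map
  exact PowerSeries.map_injective _ injective_algebraMap_comp_intToUnrCoeff h₂

include hq hθc hθζ in
/-- ★★★ **`i` is injective on `𝒰`** (de Shalit I.3.4 Corollary at `q = 2`): for norm-coherent units `β, β'` of
the Lubin–Tate tower of `f' = π'X + X²`, `π' = 2u` with `u ≠ 1`, over `F` of characteristic `0` with residue
field `𝔽₂`: if the pulled-back log-free measures `D_β`, `D_{β'}` agree levelwise then **`β = β'`**
(`PAdicOneVariableUnitsSocketInjective` ⟹ `H_β = H_{β'}` ⟹ `(δβ)~ = (δβ')~` ⟹ `δβ = δβ'` as `(·)~` is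
injective for `u ≠ 1` ⟹ `β = β'` by `logDeriv_injective` at `q = 2`).
[cite: deShalit1987, I.3.4 Corollary (p. 18), I.3.12 Corollary (p. 23)] -/
theorem NormCoherentUnits.eq_of_comap_μ_eq [CharZero F] (hu1 : (u : 𝒪[F]) ≠ 1) (n₀ : ℕ)
    (β β' : NormCoherentUnits (isUniformizer_unit_mul h2 u))
    (h : ∀ (n : ℕ) (a : absoluteGaloisGroup F ⧸ (ltTower (isUniformizer_unit_mul h2 u)).U n),
      (GroupDistribution.comap (restrictUnits ((invAmice₁ 2
        ((PowerSeries.subst ((compSeriesC h2 hσ₀ u hε).map (algebraMap (UnrCoeff F) (CBall F)))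
          ((tildeSer ((u : 𝒪[F]) * ((2 : ℕ) : 𝒪[F])) (LTCoeff.of F (u : 𝒪[F])) β.logDeriv).map
            ((algebraMap (UnrCoeff F) (CBall F)).comp
              ((intToUnrCoeff F).comp (LTCoeff.of F).symm.toRingHom)))).map (θ.comp (CBall F).subtype))
        (norm_coeff_map_le_one θ hθ1
          (PowerSeries.subst ((compSeriesC h2 hσ₀ u hε).map (algebraMap (UnrCoeff F) (CBall F)))
            ((tildeSer ((u : 𝒪[F]) * ((2 : ℕ) : 𝒪[F])) (LTCoeff.of F (u : 𝒪[F])) β.logDeriv).map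
              ((algebraMap (UnrCoeff F) (CBall F)).comp
                ((intToUnrCoeff F).comp (LTCoeff.of F).symm.toRingHom)))))).density
        (ProfiniteTower.padicInt_isUniform 2) (unitInv ℂ_[2]) uniformContinuous_unitInv norm_unitInv_le))
        ψ ((ltTower (isUniformizer_unit_mul h2 u)).cellMap_trans _ ψ hψ)
        ((ltTower (isUniformizer_unit_mul h2 u)).cellMap_injective _
          (mem_ltTower_iff (isUniformizer_unit_mul h2 u) e) ψ hψ)
        ((ltTower (isUniformizer_unit_mul h2 u)).cellMap_fiberSurj _
          (mem_ltTower_iff (isUniformizer_unit_mul h2 u) e)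
          (exists_toZModPow_ltCharacter_eq (isUniformizer_unit_mul h2 u) e) ψ hψ)).μ n a =
      (GroupDistribution.comap (restrictUnits ((invAmice₁ 2
        ((PowerSeries.subst ((compSeriesC h2 hσ₀ u hε).map (algebraMap (UnrCoeff F) (CBall F)))
          ((tildeSer ((u : 𝒪[F]) * ((2 : ℕ) : 𝒪[F])) (LTCoeff.of F (u : 𝒪[F])) β'.logDeriv).map
            ((algebraMap (UnrCoeff F) (CBall F)).comp
              ((intToUnrCoeff F).comp (LTCoeff.of F).symm.toRingHom)))).map (θ.comp (CBall F).subtype))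
        (norm_coeff_map_le_one θ hθ1
          (PowerSeries.subst ((compSeriesC h2 hσ₀ u hε).map (algebraMap (UnrCoeff F) (CBall F)))
            ((tildeSer ((u : 𝒪[F]) * ((2 : ℕ) : 𝒪[F])) (LTCoeff.of F (u : 𝒪[F])) β'.logDeriv).map
              ((algebraMap (UnrCoeff F) (CBall F)).comp
                ((intToUnrCoeff F).comp (LTCoeff.of F).symm.toRingHom)))))).density
        (ProfiniteTower.padicInt_isUniform 2) (unitInv ℂ_[2]) uniformContinuous_unitInv norm_unitInv_le))
        ψ ((ltTower (isUniformizer_unit_mul h2 u)).cellMap_trans _ ψ hψ)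
        ((ltTower (isUniformizer_unit_mul h2 u)).cellMap_injective _
          (mem_ltTower_iff (isUniformizer_unit_mul h2 u) e) ψ hψ)
        ((ltTower (isUniformizer_unit_mul h2 u)).cellMap_fiberSurj _
          (mem_ltTower_iff (isUniformizer_unit_mul h2 u) e)
          (exists_toZModPow_ltCharacter_eq (isUniformizer_unit_mul h2 u) e) ψ hψ)).μ n a) :
    β = β' := by
  have h₁ := map_subst_tildeSer_logDeriv_eq_of_comap_μ_eq hq h2 hσ₀ u hε θ hθc hθ1 hθζ e ψ hψ n₀ β β' h
  have h₂ := tildeSer_logDeriv_eq_of_map_subst_eq h2 hσ₀ u hε θ β β' h₁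
  have hu' : LTCoeff.of F (u : 𝒪[F]) ≠ 1 := fun h1 ↦ hu1 (by
    have := congrArg (LTCoeff.of F).symm h1
    rwa [RingEquiv.symm_apply_apply, map_one] at this)
  have h₃ := tildeSer_injective_of_ne_one ((u : 𝒪[F]) * ((2 : ℕ) : 𝒪[F])) (isUniformizer_unit_mul h2 u) hu' h₂
  exact NormCoherentUnits.logDeriv_injective (isUniformizer_unit_mul h2 u) hq h₃

end NormCoherentUnitsInjective

end Literature.NumberTheory.EllipticCurves

end
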